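import Summits.BirchSwinnertonDyer.BirchSwinnertonDyer.Theorems.ManinLocalTwoThreeManinPrimeToThreeAtNineOfKatoFact
import Summits.BirchSwinnertonDyer.BirchSwinnertonDyer.Theorems.ManinLocalTwoThreeManinPrimeToThreeOfEtaExponentOfCube
import Summits.BirchSwinnertonDyer.BirchSwinnertonDyer.Theorems.ManinLocalTwoThreeManinOddOfReducibleOfCuspidalKummer
import Summits.BirchSwinnertonDyer.Rank1Residual.ManinAdditive.CuspidalKummerClass
import Summits.BirchSwinnertonDyer.Rank1Residual.ManinAdditive.KatoShiftThreeLaws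
import HarnessLib

/-!
# The reducible residual of C3 BY NAME from the `p = 3` cuspidal-Kummer (tangent-line) programme:
# `ManinPrimeToThreeOfReducible ⟸ E-an-57 ∧ E-an-55 ∧ LAW₃ ∧ RES₃`, hence
# `ManinPrimeToThreeAtNine ⟸ F-es-18 ∧ E-an-57 ∧ E-an-55 ∧ LAW₃ ∧ RES₃`

Summit `BirchSwinnertonDyer`, route `ManinLocalTwoThree` (cell bsd-f2-manin), crux C3 `ManinPrimeToThreeAtNine`
(stmt-BirchSwinnertonDyer-22968).  Gen 3 of the lead reduced C3 kernel-exactly to Kato's `p = 3` fact F-es-18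
(`kato_neron_isIntegral_twistedSymbolSum_of_additive_three_polar`, Literature, statement-only) and the `W[3]`-REDUCIBLE
residual (`ManinPrimeToThreeOfReducible`, resp. its orbit-minimal form; p617384).  The an planner's `p = 3` twin of the
cuspidal-Kummer certificate (MEMO-an §56.7/§56.12; tree leaf `…ManinAdditive.CuspidalKummerClass`, namespace
`CuspidalKummerThree`) supplies, for curves with a RATIONAL point of order `3` (496 of the 729 classes of `Rb(3)` with
`N ≤ 5000`):

* E-an-57 `CuspidalKummerCubeRepresentativeAtNine` (crux K_geo at `9 ∣ N`: `ι(T) ∈ J₀(N)[3](ℚ)` is rationally cuspidal,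
  `η`-representable) — OPEN;
* E-an-55 `ManinThreeKummerCube` (`3 ∣ c ⇒ Θ_T` is a cube in `Frac ℤ₃⟦q⟧`; theorem-grade, Honda at `3`) — OPEN in the tree;
  with it the CERTIFICATE E-an-58 `ManinPrimeToThreeOfEtaExponent` is a tree theorem (p3:
  `maninPrimeToThreeOfEtaExponent_of_maninThreeKummerCube`, using `EtaUnitCubeIffThree_holds`);
* LAW₃ (the `p = 3` twin of E-an-53, NOT yet typed by the cell — stated inline here): every cuspidal cube representative
  of a rational `3`-torsion point has an `η`-exponent NOT divisible by `3` (an's census: the intrinsic class is a non-cube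
  in 496/496 classes; «0 blind» at `p = 3`) — OPEN, `c`-free;
* RES₃ (inline): the `W[3]`-reducible optimal curves with `9 ∣ N` and NO rational point of order `3` on the short model
  (a `3`-isogeny whose kernel is not pointwise rational; 233/729 classes `≤ 5000`; an: «twisted variant needed») — OPEN.

THIS FILE proves the compositions BY NAME: `maninPrimeToThreeOfReducible_of_cuspidalKummerCube`
(E-an-57 → E-an-55 → LAW₃ → RES₃ → `ManinPrimeToThreeOfReducible`), its ORBIT-MINIMAL form (RES₃ restricted by the six
twist-orbit-minimality clauses of p617384, verbatim), and the C3 corollaries through the lead's gen-3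
`maninPrimeToThreeAtNine_of_katoFact_of_reducible` / `…_of_orbitMinimalReducible`.  No model glue is needed at `p = 3`:
the rows are phrased on the short model `E_{W,c}` and the dichotomy «some / no rational `3`-torsion point on it» is
logical.  HONEST FRAMING: a CONDITIONAL reduction; F-es-18 is statement-only, E-an-57, LAW₃, RES₃ are open (E-an-55 is
theorem-grade but unproved in the tree); nothing about BSD or Manin's conjecture is proved here.
-/

set_option autoImplicit false
set_option linter.dupNamespace false

noncomputable section

open scoped Classical MatrixGroups ModularForm
open PowerSeries CongruenceSubgroup
open WeierstrassCurve Literature.NumberTheory.EllipticCurves Literature.NumberTheory.EllipticCurves.ModularForms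
open Summit.BirchSwinnertonDyer.Rank1Residual.ManinAdditive
open Summit.BirchSwinnertonDyer.Rank1Residual.ManinAdditive.CuspidalKummer
open Summit.BirchSwinnertonDyer.Rank1Residual.ManinAdditive.CuspidalKummerThree

namespace Summit.BirchSwinnertonDyer.BirchSwinnertonDyer.Theorems.ManinLocalTwoThree

/-- **The reducible residual of C3 from the `p = 3` cuspidal-Kummer programme, BY NAME**:
`E-an-57 → E-an-55 → LAW₃ → RES₃ → ManinPrimeToThreeOfReducible` (E-an-58 from E-an-55 by p3's tree theorem).
CONDITIONAL reduction. [folklore] -/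
theorem maninPrimeToThreeOfReducible_of_cuspidalKummerCube
    (h57 : CuspidalKummerCubeRepresentativeAtNine) (h55 : ManinThreeKummerCube)
    (hLaw :
    ∀ (W : WeierstrassCurve ℚ) [W.IsElliptic] [W.IsGloballyMinimal] {N : ℕ} [NeZero N]
      (D : ModularParametrizationData W N) (a : ℕ → ℤ), (∀ n, (a n : ℂ) = cuspCoeff D.f n) →
      9 ∣ N → (∀ z ∈ D.L.lattice, ∃ w ∈ periodLattice D.f, z = D.c * w) →
      ∀ X₀ Y₀ : ℚ, IsShortThreeTorsion W D.c X₀ Y₀ →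
      ∀ z : ℚ⟦X⟧, IsParamGerm W D.c a z →
      ∀ (r : ℕ → ℤ) (g A B : ℤ⟦X⟧), IsCuspidalKummerCubeRep N (kummerCubeSeries W D.c X₀ Y₀ z) r g A B →
      ∃ δ ∈ N.divisors, ¬ (3 : ℤ) ∣ r δ)
    (hRes :
    ∀ (W : WeierstrassCurve ℚ) [W.IsElliptic] [W.IsGloballyMinimal] {N : ℕ} [NeZero N]
      (D : ModularParametrizationData W N),
      (∀ z ∈ D.L.lattice, ∃ w ∈ periodLattice D.f, z = D.c * w) → 3 ^ 2 ∣ N →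
      ¬ W.HasIrreducibleModPGaloisRep 3 → (∀ X₀ Y₀ : ℚ, ¬ IsShortThreeTorsion W D.c X₀ Y₀) → ¬ (3 : ℤ) ∣ D.c) :
    ManinPrimeToThreeOfReducible := by
  intro W _ _ N _ D hopt h9 hred
  have h9' : 9 ∣ N := by norm_num at h9; exact h9
  by_cases hT : ∃ X₀ Y₀ : ℚ, IsShortThreeTorsion W D.c X₀ Y₀
  · obtain ⟨X₀, Y₀, hT⟩ := hT
    set a : ℕ → ℤ := fun n => W.LFunction n with ha_def
    have ha : ∀ n, (a n : ℂ) = cuspCoeff D.f n := fun n => (D.isNewformOf.2 n).symm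
    obtain ⟨z, hz⟩ := exists_isParamGerm W D.c a
    obtain ⟨r, g, A, B, hrep⟩ := h57 W D a ha h9' hopt X₀ Y₀ hT z hz
    have hδ : ∃ δ ∈ N.divisors, ¬ (3 : ℤ) ∣ r δ := hLaw W D a ha h9' hopt X₀ Y₀ hT z hz r g A B hrep
    exact maninPrimeToThreeOfEtaExponent_of_maninThreeKummerCube h55 W D a ha h9' X₀ Y₀ hT z hz r g A B hrep hδ
  · push Not at hT
    exact hRes W D hopt h9 hred hT

/-- **C3 `ManinPrimeToThreeAtNine` BY NAME from Kato's `p = 3` fact F-es-18, K_geo₃ (E-an-57), E-an-55, LAW₃ and RES₃**,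
through the lead's gen-3 `maninPrimeToThreeAtNine_of_katoFact_of_reducible`.  CONDITIONAL; nothing about BSD or Manin's
conjecture is proved. [cite: Kato2004Asterisque, Thm. 9.7 (p. 189)] -/
theorem maninPrimeToThreeAtNine_of_katoFact_of_cuspidalKummerCube
    (hK : kato_neron_isIntegral_twistedSymbolSum_of_additive_three_polar)
    (h57 : CuspidalKummerCubeRepresentativeAtNine) (h55 : ManinThreeKummerCube)
    (hLaw :
    ∀ (W : WeierstrassCurve ℚ) [W.IsElliptic] [W.IsGloballyMinimal] {N : ℕ} [NeZero N]
      (D : ModularParametrizationData W N) (a : ℕ → ℤ), (∀ n, (a n : ℂ) = cuspCoeff D.f n) →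
      9 ∣ N → (∀ z ∈ D.L.lattice, ∃ w ∈ periodLattice D.f, z = D.c * w) →
      ∀ X₀ Y₀ : ℚ, IsShortThreeTorsion W D.c X₀ Y₀ →
      ∀ z : ℚ⟦X⟧, IsParamGerm W D.c a z →
      ∀ (r : ℕ → ℤ) (g A B : ℤ⟦X⟧), IsCuspidalKummerCubeRep N (kummerCubeSeries W D.c X₀ Y₀ z) r g A B →
      ∃ δ ∈ N.divisors, ¬ (3 : ℤ) ∣ r δ)
    (hRes :
    ∀ (W : WeierstrassCurve ℚ) [W.IsElliptic] [W.IsGloballyMinimal] {N : ℕ} [NeZero N]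
      (D : ModularParametrizationData W N),
      (∀ z ∈ D.L.lattice, ∃ w ∈ periodLattice D.f, z = D.c * w) → 3 ^ 2 ∣ N →
      ¬ W.HasIrreducibleModPGaloisRep 3 → (∀ X₀ Y₀ : ℚ, ¬ IsShortThreeTorsion W D.c X₀ Y₀) → ¬ (3 : ℤ) ∣ D.c) :
    Summit.BirchSwinnertonDyer.BirchSwinnertonDyer.Theses.ManinLocalTwoThree.ManinPrimeToThreeAtNine :=
  maninPrimeToThreeAtNine_of_katoFact_of_reducible hK
    (maninPrimeToThreeOfReducible_of_cuspidalKummerCube h57 h55 hLaw hRes)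

/-! ### Orbit-minimal form (the residual restricted by the six twist-orbit-minimality clauses of p617384, verbatim) -/

/-- **The ORBIT-MINIMAL reducible residual of C3 (p617384's `hB`, verbatim) from E-an-57, E-an-55, LAW₃ and the
ORBIT-MINIMAL no-rational-3-torsion residual RES₃′.** CONDITIONAL reduction. [folklore] -/
theorem orbitMinimalReducibleResidualThree_of_cuspidalKummerCube
    (h57 : CuspidalKummerCubeRepresentativeAtNine) (h55 : ManinThreeKummerCube)
    (hLaw :
    ∀ (W : WeierstrassCurve ℚ) [W.IsElliptic] [W.IsGloballyMinimal] {N : ℕ} [NeZero N]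
      (D : ModularParametrizationData W N) (a : ℕ → ℤ), (∀ n, (a n : ℂ) = cuspCoeff D.f n) →
      9 ∣ N → (∀ z ∈ D.L.lattice, ∃ w ∈ periodLattice D.f, z = D.c * w) →
      ∀ X₀ Y₀ : ℚ, IsShortThreeTorsion W D.c X₀ Y₀ →
      ∀ z : ℚ⟦X⟧, IsParamGerm W D.c a z →
      ∀ (r : ℕ → ℤ) (g A B : ℤ⟦X⟧), IsCuspidalKummerCubeRep N (kummerCubeSeries W D.c X₀ Y₀ z) r g A B →
      ∃ δ ∈ N.divisors, ¬ (3 : ℤ) ∣ r δ)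
    (hRes :
    ∀ (W : WeierstrassCurve ℚ) [W.IsElliptic] [W.IsGloballyMinimal] {N : ℕ} [NeZero N]
      (D : ModularParametrizationData W N),
      (∀ z ∈ D.L.lattice, ∃ w ∈ periodLattice D.f, z = D.c * w) → 3 ^ 2 ∣ N →
      ¬ (∃ (W' : WeierstrassCurve ℚ) (d : ℤ), W'.IsElliptic ∧ W'.IsGloballyMinimal ∧
        (d = -3) ∧ IsIsogenous W (W'.quadraticTwist (d : ℚ)) ∧
        ¬ 3 ^ 2 ∣ W'.conductorNorm ℤ) →
      ¬ (∃ (W' : WeierstrassCurve ℚ) (q : ℕ), W'.IsElliptic ∧ W'.IsGloballyMinimal ∧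
        q.Prime ∧ q ≠ 2 ∧ q ≠ 3 ∧ q ^ 2 ∣ N ∧
        IsIsogenous W (W'.quadraticTwist (((-1 : ℤ) ^ (q / 2) * q : ℤ) : ℚ)) ∧
        ¬ q ^ 2 ∣ W'.conductorNorm ℤ) →
      ¬ (∃ (W' : WeierstrassCurve ℚ) (d : ℤ), W'.IsElliptic ∧ W'.IsGloballyMinimal ∧
        (d = -1 ∨ d = 2 ∨ d = -2) ∧ 2 ^ 2 ∣ N ∧ IsIsogenous W (W'.quadraticTwist (d : ℚ)) ∧
        ¬ 2 ^ 2 ∣ W'.conductorNorm ℤ) →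
      ¬ (∃ (A : WeierstrassCurve ℚ), A.IsElliptic ∧ A.IsGloballyMinimal ∧ 2 ^ 4 ∣ N ∧
        2 ^ 2 ∣ A.conductorNorm ℤ ∧ A.conductorNorm ℤ ∣ N ∧ A.conductorNorm ℤ < N ∧
        IsIsogenous W (A.quadraticTwist ((-1 : ℤ) : ℚ))) →
      ¬ (∃ (A : WeierstrassCurve ℚ) (_ : A.IsElliptic) (_ : A.IsGloballyMinimal) (N' : ℕ) (_ : NeZero N')
        (D' : ModularParametrizationData A N') (d : ℤ) (C : WeierstrassCurve ℚ) (u : VariableChange ℚ),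
        C.IsElliptic ∧ C.IsGloballyMinimal ∧
        (∀ z ∈ D'.L.lattice, ∃ w ∈ periodLattice D'.f, z = D'.c * w) ∧ (d = 2 ∨ d = -2) ∧ 2 ^ 6 ∣ N ∧
        2 ^ 2 ∣ A.conductorNorm ℤ ∧ A.conductorNorm ℤ ∣ N ∧
        IsIsogenous W (A.quadraticTwist (d : ℚ)) ∧ u • A.quadraticTwist (d : ℚ) = C ∧
        C.Δ = (d : ℚ) ^ 6 * A.Δ ∧
        (A.conductorNorm ℤ < N ∨ A.minimalDiscriminantInt.natAbs < W.minimalDiscriminantInt.natAbs)) →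
      ¬ (∃ (A : WeierstrassCurve ℚ) (_ : A.IsElliptic) (_ : A.IsGloballyMinimal)
        (D' : ModularParametrizationData A N) (q : ℕ) (C : WeierstrassCurve ℚ) (u : VariableChange ℚ),
        C.IsElliptic ∧ C.IsGloballyMinimal ∧
        (∀ z ∈ D'.L.lattice, ∃ w ∈ periodLattice D'.f, z = D'.c * w) ∧ q.Prime ∧ q ≠ 2 ∧ q ^ 2 ∣ N ∧
        IsIsogenous C W ∧ u • A.quadraticTwist (((-1 : ℤ) ^ (q / 2) * q : ℤ) : ℚ) = C ∧
        C.Δ = ((((-1 : ℤ) ^ (q / 2) * q : ℤ)) : ℚ) ^ 6 * A.Δ ∧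
        A.minimalDiscriminantInt.natAbs < W.minimalDiscriminantInt.natAbs) →
      ¬ W.HasIrreducibleModPGaloisRep 3 → (∀ X₀ Y₀ : ℚ, ¬ IsShortThreeTorsion W D.c X₀ Y₀) → ¬ (3 : ℤ) ∣ D.c) :
    ∀ (W : WeierstrassCurve ℚ) [W.IsElliptic] [W.IsGloballyMinimal] {N : ℕ} [NeZero N]
      (D : ModularParametrizationData W N),
      (∀ z ∈ D.L.lattice, ∃ w ∈ periodLattice D.f, z = D.c * w) → 3 ^ 2 ∣ N →
      ¬ (∃ (W' : WeierstrassCurve ℚ) (d : ℤ), W'.IsElliptic ∧ W'.IsGloballyMinimal ∧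
        (d = -3) ∧ IsIsogenous W (W'.quadraticTwist (d : ℚ)) ∧
        ¬ 3 ^ 2 ∣ W'.conductorNorm ℤ) →
      ¬ (∃ (W' : WeierstrassCurve ℚ) (q : ℕ), W'.IsElliptic ∧ W'.IsGloballyMinimal ∧
        q.Prime ∧ q ≠ 2 ∧ q ≠ 3 ∧ q ^ 2 ∣ N ∧
        IsIsogenous W (W'.quadraticTwist (((-1 : ℤ) ^ (q / 2) * q : ℤ) : ℚ)) ∧
        ¬ q ^ 2 ∣ W'.conductorNorm ℤ) →
      ¬ (∃ (W' : WeierstrassCurve ℚ) (d : ℤ), W'.IsElliptic ∧ W'.IsGloballyMinimal ∧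
        (d = -1 ∨ d = 2 ∨ d = -2) ∧ 2 ^ 2 ∣ N ∧ IsIsogenous W (W'.quadraticTwist (d : ℚ)) ∧
        ¬ 2 ^ 2 ∣ W'.conductorNorm ℤ) →
      ¬ (∃ (A : WeierstrassCurve ℚ), A.IsElliptic ∧ A.IsGloballyMinimal ∧ 2 ^ 4 ∣ N ∧
        2 ^ 2 ∣ A.conductorNorm ℤ ∧ A.conductorNorm ℤ ∣ N ∧ A.conductorNorm ℤ < N ∧
        IsIsogenous W (A.quadraticTwist ((-1 : ℤ) : ℚ))) →
      ¬ (∃ (A : WeierstrassCurve ℚ) (_ : A.IsElliptic) (_ : A.IsGloballyMinimal) (N' : ℕ) (_ : NeZero N')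
        (D' : ModularParametrizationData A N') (d : ℤ) (C : WeierstrassCurve ℚ) (u : VariableChange ℚ),
        C.IsElliptic ∧ C.IsGloballyMinimal ∧
        (∀ z ∈ D'.L.lattice, ∃ w ∈ periodLattice D'.f, z = D'.c * w) ∧ (d = 2 ∨ d = -2) ∧ 2 ^ 6 ∣ N ∧
        2 ^ 2 ∣ A.conductorNorm ℤ ∧ A.conductorNorm ℤ ∣ N ∧
        IsIsogenous W (A.quadraticTwist (d : ℚ)) ∧ u • A.quadraticTwist (d : ℚ) = C ∧
        C.Δ = (d : ℚ) ^ 6 * A.Δ ∧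
        (A.conductorNorm ℤ < N ∨ A.minimalDiscriminantInt.natAbs < W.minimalDiscriminantInt.natAbs)) →
      ¬ (∃ (A : WeierstrassCurve ℚ) (_ : A.IsElliptic) (_ : A.IsGloballyMinimal)
        (D' : ModularParametrizationData A N) (q : ℕ) (C : WeierstrassCurve ℚ) (u : VariableChange ℚ),
        C.IsElliptic ∧ C.IsGloballyMinimal ∧
        (∀ z ∈ D'.L.lattice, ∃ w ∈ periodLattice D'.f, z = D'.c * w) ∧ q.Prime ∧ q ≠ 2 ∧ q ^ 2 ∣ N ∧
        IsIsogenous C W ∧ u • A.quadraticTwist (((-1 : ℤ) ^ (q / 2) * q : ℤ) : ℚ) = C ∧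
        C.Δ = ((((-1 : ℤ) ^ (q / 2) * q : ℤ)) : ℚ) ^ 6 * A.Δ ∧
        A.minimalDiscriminantInt.natAbs < W.minimalDiscriminantInt.natAbs) →
      ¬ W.HasIrreducibleModPGaloisRep 3 → ¬ (3 : ℤ) ∣ D.c := by
  intro W _ _ N _ D hopt h9 hc1 hc2 hc3 hc4 hc5 hc6 hred
  have h9' : 9 ∣ N := by norm_num at h9; exact h9
  by_cases hT : ∃ X₀ Y₀ : ℚ, IsShortThreeTorsion W D.c X₀ Y₀
  · obtain ⟨X₀, Y₀, hT⟩ := hT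
    set a : ℕ → ℤ := fun n => W.LFunction n with ha_def
    have ha : ∀ n, (a n : ℂ) = cuspCoeff D.f n := fun n => (D.isNewformOf.2 n).symm
    obtain ⟨z, hz⟩ := exists_isParamGerm W D.c a
    obtain ⟨r, g, A, B, hrep⟩ := h57 W D a ha h9' hopt X₀ Y₀ hT z hz
    have hδ : ∃ δ ∈ N.divisors, ¬ (3 : ℤ) ∣ r δ := hLaw W D a ha h9' hopt X₀ Y₀ hT z hz r g A B hrep
    exact maninPrimeToThreeOfEtaExponent_of_maninThreeKummerCube h55 W D a ha h9' X₀ Y₀ hT z hz r g A B hrep hδ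
  · push Not at hT
    exact hRes W D hopt h9 hc1 hc2 hc3 hc4 hc5 hc6 hred hT

/-- **C3 BY NAME from F-es-18, E-an-57, E-an-55, LAW₃ and the ORBIT-MINIMAL residual RES₃′**, through the lead's gen-3
`maninPrimeToThreeAtNine_of_katoFact_of_orbitMinimalReducible`.  CONDITIONAL; nothing about BSD or Manin's conjecture is
proved. [cite: Kato2004Asterisque, Thm. 9.7 (p. 189)] -/
theorem maninPrimeToThreeAtNine_of_katoFact_of_cuspidalKummerCube_of_orbitMinimal
    (hK : kato_neron_isIntegral_twistedSymbolSum_of_additive_three_polar)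
    (h57 : CuspidalKummerCubeRepresentativeAtNine) (h55 : ManinThreeKummerCube)
    (hLaw :
    ∀ (W : WeierstrassCurve ℚ) [W.IsElliptic] [W.IsGloballyMinimal] {N : ℕ} [NeZero N]
      (D : ModularParametrizationData W N) (a : ℕ → ℤ), (∀ n, (a n : ℂ) = cuspCoeff D.f n) →
      9 ∣ N → (∀ z ∈ D.L.lattice, ∃ w ∈ periodLattice D.f, z = D.c * w) →
      ∀ X₀ Y₀ : ℚ, IsShortThreeTorsion W D.c X₀ Y₀ →
      ∀ z : ℚ⟦X⟧, IsParamGerm W D.c a z →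
      ∀ (r : ℕ → ℤ) (g A B : ℤ⟦X⟧), IsCuspidalKummerCubeRep N (kummerCubeSeries W D.c X₀ Y₀ z) r g A B →
      ∃ δ ∈ N.divisors, ¬ (3 : ℤ) ∣ r δ)
    (hRes :
    ∀ (W : WeierstrassCurve ℚ) [W.IsElliptic] [W.IsGloballyMinimal] {N : ℕ} [NeZero N]
      (D : ModularParametrizationData W N),
      (∀ z ∈ D.L.lattice, ∃ w ∈ periodLattice D.f, z = D.c * w) → 3 ^ 2 ∣ N →
      ¬ (∃ (W' : WeierstrassCurve ℚ) (d : ℤ), W'.IsElliptic ∧ W'.IsGloballyMinimal ∧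
        (d = -3) ∧ IsIsogenous W (W'.quadraticTwist (d : ℚ)) ∧
        ¬ 3 ^ 2 ∣ W'.conductorNorm ℤ) →
      ¬ (∃ (W' : WeierstrassCurve ℚ) (q : ℕ), W'.IsElliptic ∧ W'.IsGloballyMinimal ∧
        q.Prime ∧ q ≠ 2 ∧ q ≠ 3 ∧ q ^ 2 ∣ N ∧
        IsIsogenous W (W'.quadraticTwist (((-1 : ℤ) ^ (q / 2) * q : ℤ) : ℚ)) ∧
        ¬ q ^ 2 ∣ W'.conductorNorm ℤ) →
      ¬ (∃ (W' : WeierstrassCurve ℚ) (d : ℤ), W'.IsElliptic ∧ W'.IsGloballyMinimal ∧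
        (d = -1 ∨ d = 2 ∨ d = -2) ∧ 2 ^ 2 ∣ N ∧ IsIsogenous W (W'.quadraticTwist (d : ℚ)) ∧
        ¬ 2 ^ 2 ∣ W'.conductorNorm ℤ) →
      ¬ (∃ (A : WeierstrassCurve ℚ), A.IsElliptic ∧ A.IsGloballyMinimal ∧ 2 ^ 4 ∣ N ∧
        2 ^ 2 ∣ A.conductorNorm ℤ ∧ A.conductorNorm ℤ ∣ N ∧ A.conductorNorm ℤ < N ∧
        IsIsogenous W (A.quadraticTwist ((-1 : ℤ) : ℚ))) →
      ¬ (∃ (A : WeierstrassCurve ℚ) (_ : A.IsElliptic) (_ : A.IsGloballyMinimal) (N' : ℕ) (_ : NeZero N')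
        (D' : ModularParametrizationData A N') (d : ℤ) (C : WeierstrassCurve ℚ) (u : VariableChange ℚ),
        C.IsElliptic ∧ C.IsGloballyMinimal ∧
        (∀ z ∈ D'.L.lattice, ∃ w ∈ periodLattice D'.f, z = D'.c * w) ∧ (d = 2 ∨ d = -2) ∧ 2 ^ 6 ∣ N ∧
        2 ^ 2 ∣ A.conductorNorm ℤ ∧ A.conductorNorm ℤ ∣ N ∧
        IsIsogenous W (A.quadraticTwist (d : ℚ)) ∧ u • A.quadraticTwist (d : ℚ) = C ∧
        C.Δ = (d : ℚ) ^ 6 * A.Δ ∧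
        (A.conductorNorm ℤ < N ∨ A.minimalDiscriminantInt.natAbs < W.minimalDiscriminantInt.natAbs)) →
      ¬ (∃ (A : WeierstrassCurve ℚ) (_ : A.IsElliptic) (_ : A.IsGloballyMinimal)
        (D' : ModularParametrizationData A N) (q : ℕ) (C : WeierstrassCurve ℚ) (u : VariableChange ℚ),
        C.IsElliptic ∧ C.IsGloballyMinimal ∧
        (∀ z ∈ D'.L.lattice, ∃ w ∈ periodLattice D'.f, z = D'.c * w) ∧ q.Prime ∧ q ≠ 2 ∧ q ^ 2 ∣ N ∧
        IsIsogenous C W ∧ u • A.quadraticTwist (((-1 : ℤ) ^ (q / 2) * q : ℤ) : ℚ) = C ∧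
        C.Δ = ((((-1 : ℤ) ^ (q / 2) * q : ℤ)) : ℚ) ^ 6 * A.Δ ∧
        A.minimalDiscriminantInt.natAbs < W.minimalDiscriminantInt.natAbs) →
      ¬ W.HasIrreducibleModPGaloisRep 3 → (∀ X₀ Y₀ : ℚ, ¬ IsShortThreeTorsion W D.c X₀ Y₀) → ¬ (3 : ℤ) ∣ D.c) :
    Summit.BirchSwinnertonDyer.BirchSwinnertonDyer.Theses.ManinLocalTwoThree.ManinPrimeToThreeAtNine :=
  maninPrimeToThreeAtNine_of_katoFact_of_orbitMinimalReducible hK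
    (orbitMinimalReducibleResidualThree_of_cuspidalKummerCube h57 h55 hLaw hRes)

end Summit.BirchSwinnertonDyer.BirchSwinnertonDyer.Theorems.ManinLocalTwoThree

end
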